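import Literature.Analysis.Matrix.NonnegMatrixFamilyNeumannBound
import Mathlib.Analysis.Convex.Slope
import Mathlib.Topology.Instances.Matrix
import Mathlib.Topology.Order.MonotoneConvergence
import Mathlib.Topology.Algebra.Order.LiminfLimsup
import HarnessLib

/-!
# The Neumann series of a monotone, convex, irreducible family of non-negative matrices has a rank-one residue at the end
# of its interval of convergence — with no Perron–Frobenius theory

Topic `Literature/Analysis/Matrix` (continues `NonnegMatrixFamilyNeumannBound.lean`, whose entrywise order tools are reused).  Sources of
the SETTING and of the classical statement: E. Seneta, *Non-negative Matrices* (1973), Chapter 6 "R-theory" — §6.1 Theorem 6.1 (the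
resolvent series `Σ_k T^k z^k` of an irreducible `T`, common convergence radius `R`, the inequalities `t^{(ν+k)}_{ij} ≥ t^{(ν)}_{ik} t^{(k)}_{kj}`),
§6.2 Theorem 6.3 (sub-invariant vectors; behaviour at the convergence parameter) — and Chapter 1, §1.4 (the Perron–Frobenius theorem for an
irreducible matrix: uniqueness of the positive eigenvector); W. Feller, *An Introduction to Probability Theory and its Applications* II (1971), XIV §1 (the renewal
equation `U = 1 + F U`; the renewal constant `1/μ`).  In print the residue of `(1 − T(y))⁻¹` at the critical parameter of an analytic irreducible
family is obtained from Perron–Frobenius theory (simplicity of the maximal eigenvalue).  (The tree HAS that theorem — `Literature/LinearAlgebra/Matrix/PerronFrobeniusIrreducible.lean`, Ding–Zhou 2009 Thm 2.6 — but it is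
not needed and not imported here.)  Here NO spectral theory is used: the residue is pinned
by (i) the two-sided first-order bounds `c/(R − y) ≤ (Σ_k I(y)^k)_{ab} ≤ C/(R − y)`, (ii) monotonicity and convexity of the entries (as for power
series with non-negative coefficients), (iii) irreducibility — through compactness of the rescaled resolvents and uniqueness of their cluster values.
Motivation (lane «pcv-sawmu», a-p2 g18): `I(y)` = the generating matrix of irreducible horizontal Duminil-Copin–Hammond bridges of the width-`T`
honeycomb strip by entrance/exit level (`HexSAWStripBridgeRenewal.lean`), `R = y_T` the surface-adsorption threshold; the theorem gives the
EXISTENCE of the renewal constant of the strip's bridge kernel (a separate module instantiates it).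

## What is proved (namespace `Literature.Analysis.Matrix`; `ι` finite; matrices `ι × ι` over `ℝ`)

* §A `neumannSum A = (Σ'_k (A^k)_{ab})_{ab}`; `S = 1 + A S = 1 + S A`, `S (1 − A) = 1 = (1 − A) S` when every entry series is summable; ★ the
  RESOLVENT IDENTITY `neumannSum_sub_neumannSum : S(A') − S(A) = S(A') (A' − A) S(A)`.
* §B (no spectral theory) `exists_eq_smul_of_mulVec_eq`: for `A ≥ 0` irreducible with a positive fixed vector `u` (`A u = u`), every real fixed
  vector is a multiple of `u` (the minimum-ratio argument); row version `exists_eq_smul_of_vecMul_eq`.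
* §C the setting `NeumannFamily I y₀ R c C` (entrywise `0 ≤ I(y)` non-decreasing and convex on `[y₀, R)`, `I(y₀)` irreducible, summable Neumann
  series, two-sided first-order bounds with `0 < c`) and its consequences: ★ `sub_le_mul_sub : I(y')_{pq} − I(y)_{pq} ≤ (C/c²)(R − y)` for
  `y ≤ y'` (from the resolvent identity and the bounds — the family is LIPSCHITZ AT THE ENDPOINT, i.e. the "mean renewal time" is finite for
  free); the limit matrix `Ilim = I(R⁻)` (`tendsto_apply_Ilim`), irreducible and `≥ 0`; the chord slopes `slope y = (I(R⁻) − I(y))/(R − y)`,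
  non-decreasing in `y` by convexity (`slope_mono`, via Mathlib's `ConvexOn.secant_mono_aux3`) and bounded, hence convergent:
  `J = lim_{y↑R} slope y` (`tendsto_slope_J`), `0 ≤ J ≤ C/c²`.
* §D `Q y = (R − y) • S(I(y))` has entries in `[c, C]`; `Q (1 − I(y)) = (R − y)·1 = (1 − I(y)) Q`; ★ `Q(y)(1 − I(R⁻)) → 0` and
  `(1 − I(R⁻)) Q(y) → 0`; ★ the normalisation identity `(Q(y) D(y)) u = u` for every fixed vector `u` of `I(R⁻)`.
* §E every cluster value `P` of `Q` as `y ↑ R` has entries in `[c, C]`, satisfies `P (1 − I(R⁻)) = 0 = (1 − I(R⁻)) P` and `(P J) u = u`; hence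
  (§B) ★★ `cluster_eq`: `P = u ℓᵀ/(ℓ · J u)` for any positive right/left fixed vectors `u, ℓ` of `I(R⁻)` — the cluster value is UNIQUE.
* §F ★★★ `NeumannFamily.exists_tendsto_Q` / `exists_tendsto_mul_neumannSum_apply`: there are positive `u, ℓ` with `I(R⁻) u = u`, `ℓ I(R⁻) = ℓ`,
  `ℓ · J u > 0`, and `(R − y) Σ_k I(y)^k → u ℓᵀ/(ℓ · J u)` as `y ↑ R` (compactness of the box `[c, C]^{ι×ι}` and uniqueness of cluster values:
  Mathlib's `IsCompact.tendsto_nhds_of_unique_mapClusterPt`).  A RANK-ONE RESIDUE WITH POSITIVE ENTRIES.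

Label: CONSOLIDATION of textbook R-theory / renewal theory (the statement is classical) with a NEW elementary proof route (no Perron–Frobenius,
no analytic continuation: two-sided first-order bounds + convexity + irreducibility + compactness); lane «pcv-sawmu», a-p2 g18, 2026-08-25.
NOT claimed: anything beyond the endpoint `R`, higher-order terms, the coefficientwise (Tauberian) renewal theorem, positivity of `J` entrywise.
-/

noncomputable section

open Finset Filter Matrix Topology
open scoped Topology

namespace Literature.Analysis.Matrix

variable {ι : Type*} [Fintype ι] [DecidableEq ι]

/-! ### §A The Neumann sum as a two-sided inverse and the resolvent identity -/

section Neumann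

variable {A : Matrix ι ι ℝ}

/-- The entrywise Neumann sum `S(A)_{ab} = Σ_k (A^k)_{ab}` (meaningful when every entry series is summable). [cite: Seneta1973, §6.1 (the series Σ_k T^k z^k)] -/
def neumannSum (A : Matrix ι ι ℝ) : Matrix ι ι ℝ := fun a b => ∑' k, (A ^ k) a b

/-- Partial sums `Σ_{k<n+1} A^k = 1 + (Σ_{k<n} A^k) A`. [cite: Seneta1973, §6.1] -/
private theorem nonnegMat_sum_range_succ_pow_eq' (A : Matrix ι ι ℝ) (n : ℕ) :
    ∑ k ∈ range (n + 1), A ^ k = 1 + (∑ k ∈ range n, A ^ k) * A := by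
  rw [Finset.sum_range_succ', pow_zero, add_comm, Finset.sum_mul]
  simp_rw [pow_succ]

/-- Entrywise convergence of the partial sums to the Neumann sum. [cite: Seneta1973, §6.1] -/
theorem tendsto_sum_range_pow_apply (hsum : ∀ a b, Summable fun k => (A ^ k) a b) (a b : ι) :
    Tendsto (fun n => (∑ k ∈ range n, A ^ k) a b) atTop (𝓝 (neumannSum A a b)) := by
  simp_rw [Matrix.sum_apply]
  exact (hsum a b).hasSum.tendsto_sum_nat

/-- `S = 1 + A S`. [cite: Seneta1973, §6.1; Feller1971, XIV §1 (renewal equation U = 1 + F U)] -/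
theorem neumannSum_eq_one_add_mul (hsum : ∀ a b, Summable fun k => (A ^ k) a b) :
    neumannSum A = 1 + A * neumannSum A := by
  ext a b
  have h1 : Tendsto (fun n => (∑ k ∈ range (n + 1), A ^ k) a b) atTop (𝓝 (neumannSum A a b)) :=
    (tendsto_sum_range_pow_apply hsum a b).comp (tendsto_add_atTop_nat 1)
  have h2 : Tendsto (fun n => (∑ k ∈ range (n + 1), A ^ k) a b) atTop (𝓝 ((1 + A * neumannSum A) a b)) := by
    simp_rw [nonnegMat_sum_range_succ_pow_eq, Matrix.add_apply, Matrix.mul_apply]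
    exact tendsto_const_nhds.add (tendsto_finsetSum _ fun c _ => (tendsto_sum_range_pow_apply hsum c b).const_mul _)
  exact tendsto_nhds_unique h1 h2

/-- `S = 1 + S A`. [cite: Seneta1973, §6.1; Feller1971, XIV §1] -/
theorem neumannSum_eq_one_add_mul' (hsum : ∀ a b, Summable fun k => (A ^ k) a b) :
    neumannSum A = 1 + neumannSum A * A := by
  ext a b
  have h1 : Tendsto (fun n => (∑ k ∈ range (n + 1), A ^ k) a b) atTop (𝓝 (neumannSum A a b)) :=
    (tendsto_sum_range_pow_apply hsum a b).comp (tendsto_add_atTop_nat 1)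
  have h2 : Tendsto (fun n => (∑ k ∈ range (n + 1), A ^ k) a b) atTop (𝓝 ((1 + neumannSum A * A) a b)) := by
    simp_rw [nonnegMat_sum_range_succ_pow_eq', Matrix.add_apply, Matrix.mul_apply]
    exact tendsto_const_nhds.add (tendsto_finsetSum _ fun c _ => (tendsto_sum_range_pow_apply hsum a c).mul_const _)
  exact tendsto_nhds_unique h1 h2

/-- `S (1 − A) = 1`. [cite: Seneta1973, §6.1] -/
theorem neumannSum_mul_one_sub (hsum : ∀ a b, Summable fun k => (A ^ k) a b) : neumannSum A * (1 - A) = 1 := by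
  have h := neumannSum_eq_one_add_mul' hsum
  rw [Matrix.mul_sub, Matrix.mul_one]
  calc neumannSum A - neumannSum A * A = (1 + neumannSum A * A) - neumannSum A * A := by rw [← h]
    _ = 1 := add_sub_cancel_right _ _

/-- `(1 − A) S = 1`. [cite: Seneta1973, §6.1] -/
theorem one_sub_mul_neumannSum (hsum : ∀ a b, Summable fun k => (A ^ k) a b) : (1 - A) * neumannSum A = 1 := by
  have h := neumannSum_eq_one_add_mul hsum
  rw [Matrix.sub_mul, Matrix.one_mul]
  calc neumannSum A - A * neumannSum A = (1 + A * neumannSum A) - A * neumannSum A := by rw [← h]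
    _ = 1 := add_sub_cancel_right _ _

/-- **Resolvent identity.** If both Neumann sums exist, `S(A') − S(A) = S(A') (A' − A) S(A)`.
[cite: Seneta1973, §6.1; Feller1971, XIV §1] -/
theorem neumannSum_sub_neumannSum {A A' : Matrix ι ι ℝ} (hsum : ∀ a b, Summable fun k => (A ^ k) a b)
    (hsum' : ∀ a b, Summable fun k => (A' ^ k) a b) :
    neumannSum A' - neumannSum A = neumannSum A' * (A' - A) * neumannSum A := by
  have h1 : neumannSum A' * (A' - A) * neumannSum A
      = neumannSum A' * ((1 - A) * neumannSum A) - (neumannSum A' * (1 - A')) * neumannSum A := by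
    simp only [Matrix.mul_sub, Matrix.sub_mul, Matrix.mul_one, Matrix.one_mul, Matrix.mul_assoc]
    abel
  rw [h1, one_sub_mul_neumannSum hsum, neumannSum_mul_one_sub hsum', Matrix.mul_one, Matrix.one_mul]

end Neumann

/-! ### §B Uniqueness of non-negative fixed vectors of an irreducible non-negative matrix (no spectral theory) -/

section FixedVector

variable {A : Matrix ι ι ℝ}

/-- If `A v = v` then `A^j v = v`. [cite: Seneta1973, §1.1] -/
private theorem pow_mulVec_eq_self_of_mulVec_eq {v : ι → ℝ} (hv : A *ᵥ v = v) (j : ℕ) : (A ^ j) *ᵥ v = v := by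
  induction j with
  | zero => simp
  | succ j ih => rw [pow_succ, ← Matrix.mulVec_mulVec, hv, ih]

/-- If `v A = v` (row vector) then `v A^j = v`. [cite: Seneta1973, §1.1] -/
private theorem vecMul_pow_eq_self_of_vecMul_eq {v : ι → ℝ} (hv : v ᵥ* A = v) (j : ℕ) : v ᵥ* (A ^ j) = v := by
  induction j with
  | zero => simp
  | succ j ih => rw [pow_succ', ← Matrix.vecMul_vecMul, hv, ih]

/-- A non-negative fixed vector of an irreducible non-negative matrix with ONE vanishing coordinate vanishes identically.
[cite: Seneta1973, §1.1 (irreducibility) and §6.2 Theorem 6.3 (sub-invariant vectors of an irreducible matrix are positive)] -/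
private theorem eq_zero_of_mulVec_eq_of_apply_eq_zero (hA : ∀ a b, 0 ≤ A a b) (hirr : ∀ a b, ∃ j, 0 < (A ^ j) a b)
    {v : ι → ℝ} (hv0 : 0 ≤ v) (hv : A *ᵥ v = v) {a : ι} (ha : v a = 0) : v = 0 := by
  funext b
  obtain ⟨j, hj⟩ := hirr a b
  have h1 : (A ^ j) a b * v b ≤ ((A ^ j) *ᵥ v) a := nonnegMat_apply_mul_le_mulVec (nonnegMat_pow_apply_nonneg hA j) hv0 a b
  rw [pow_mulVec_eq_self_of_mulVec_eq hv j, ha] at h1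
  have h2 : 0 ≤ v b := hv0 b
  have h3 : (A ^ j) a b * v b ≤ 0 := h1
  simp only [Pi.zero_apply]
  nlinarith

/-- **Uniqueness of the fixed direction.** Let `A ≥ 0` be irreducible and `u > 0` with `A u = u`.  Every real `w` with
`A w = w` is a multiple of `u`: `w = (min_a w_a/u_a) • u`.  (Elementary: `w − t u ≥ 0` vanishes at the minimising index.)
[cite: Seneta1973, §1.1 (irreducibility) and §1.4 (the Perron–Frobenius theorem for irreducible matrices: uniqueness of the positive eigenvector) — here only for the eigenvalue of a given positive fixed vector, by the minimum-ratio argument, without spectral theory] -/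
theorem exists_eq_smul_of_mulVec_eq (hA : ∀ a b, 0 ≤ A a b) (hirr : ∀ a b, ∃ j, 0 < (A ^ j) a b)
    {u : ι → ℝ} (hu : ∀ a, 0 < u a) (hAu : A *ᵥ u = u) {w : ι → ℝ} (hAw : A *ᵥ w = w) [Nonempty ι] :
    ∃ t : ℝ, w = t • u := by
  classical
  obtain ⟨a₀, -, ha₀⟩ := Finset.exists_min_image Finset.univ (fun a => w a / u a) Finset.univ_nonempty
  set t : ℝ := w a₀ / u a₀ with ht
  refine ⟨t, ?_⟩
  have hv0 : 0 ≤ w - t • u := fun a => by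
    have h := ha₀ a (Finset.mem_univ a)
    simp only [Pi.sub_apply, Pi.smul_apply, smul_eq_mul, Pi.zero_apply]
    have hua := hu a
    have : t * u a ≤ w a := by
      calc t * u a ≤ (w a / u a) * u a := mul_le_mul_of_nonneg_right h hua.le
        _ = w a := div_mul_cancel₀ _ hua.ne'
    linarith
  have hv : A *ᵥ (w - t • u) = w - t • u := by
    rw [Matrix.mulVec_sub, Matrix.mulVec_smul, hAw, hAu]
  have ha : (w - t • u) a₀ = 0 := by
    simp only [Pi.sub_apply, Pi.smul_apply, smul_eq_mul, ht]
    rw [div_mul_cancel₀ _ (hu a₀).ne', sub_self]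
  have h0 := eq_zero_of_mulVec_eq_of_apply_eq_zero hA hirr hv0 hv ha
  exact (sub_eq_zero.1 h0)

/-- Irreducibility passes to the transpose. [cite: Seneta1973, §1.1] -/
private theorem irreducible_transpose (hirr : ∀ a b, ∃ j, 0 < (A ^ j) a b) (a b : ι) : ∃ j, 0 < (Aᵀ ^ j) a b := by
  obtain ⟨j, hj⟩ := hirr b a
  exact ⟨j, by rwa [← Matrix.transpose_pow, Matrix.transpose_apply]⟩

/-- Row version of the uniqueness: `ℓ A = ℓ`, `ℓ > 0`, `m A = m` ⇒ `m = t • ℓ`. [cite: Seneta1973, §1.1 and §1.4] -/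
theorem exists_eq_smul_of_vecMul_eq (hA : ∀ a b, 0 ≤ A a b) (hirr : ∀ a b, ∃ j, 0 < (A ^ j) a b)
    {ℓ : ι → ℝ} (hℓ : ∀ a, 0 < ℓ a) (hAℓ : ℓ ᵥ* A = ℓ) {m : ι → ℝ} (hAm : m ᵥ* A = m) [Nonempty ι] :
    ∃ t : ℝ, m = t • ℓ := by
  have hAT : ∀ a b, 0 ≤ Aᵀ a b := fun a b => hA b a
  refine exists_eq_smul_of_mulVec_eq hAT (irreducible_transpose hirr) hℓ ?_ ?_
  · rwa [Matrix.mulVec_transpose]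
  · rwa [Matrix.mulVec_transpose]

end FixedVector


/-! ### §B′ Spreading a lower bound over all entries (irreducibility) -/

section Spread

variable {A₀ : Matrix ι ι ℝ}

/-- Shifted tails of a non-negative summable series are bounded by the whole sum (plumbing). [cite: Seneta1973, §6.1] -/
private theorem tsum_shift_le {f : ℕ → ℝ} (hf : Summable f) (h0 : ∀ k, 0 ≤ f k) (m : ℕ) : ∑' k, f (k + m) ≤ ∑' k, f k := by
  have h := hf.sum_add_tsum_nat_add m
  have h1 : 0 ≤ ∑ i ∈ range m, f i := Finset.sum_nonneg fun i _ => h0 i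
  linarith

/-- **Spreading.** If `A₀ ≥ 0` is irreducible there is `p > 0` such that for every `A ≥ A₀` with summable Neumann series and all
indices, `p · S(A)_{ab} ≤ S(A)_{cd}`: a lower bound on ONE entry (or on the sum of the entries) is a lower bound on all of them.
[cite: Seneta1973, §6.1 Theorem 6.1 (the inequalities spreading convergence properties between the entries of an irreducible matrix)] -/
theorem exists_pos_mul_neumannSum_le (h0 : ∀ a b, 0 ≤ A₀ a b) (hirr : ∀ a b, ∃ j, 0 < (A₀ ^ j) a b) [Nonempty ι] :
    ∃ p : ℝ, 0 < p ∧ ∀ A : Matrix ι ι ℝ, (∀ a b, A₀ a b ≤ A a b) → (∀ a b, Summable fun k => (A ^ k) a b) →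
      ∀ a b c d, p * neumannSum A a b ≤ neumannSum A c d := by
  classical
  choose jf hjf using hirr
  -- a uniform positive constant below all the irreducibility witnesses
  obtain ⟨p₀, hp₀, hp₀le⟩ : ∃ p₀ : ℝ, 0 < p₀ ∧ ∀ a b, p₀ ≤ (A₀ ^ jf a b) a b := by
    obtain ⟨a₁⟩ := ‹Nonempty ι›
    have hfin : (Set.range fun p : ι × ι => (A₀ ^ jf p.1 p.2) p.1 p.2).Finite := Set.finite_range _
    have hne' : (Set.range fun p : ι × ι => (A₀ ^ jf p.1 p.2) p.1 p.2).Nonempty := ⟨_, ⟨(a₁, a₁), rfl⟩⟩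
    obtain ⟨c, hcmem, hcmin⟩ := Set.exists_min_image _ id hfin hne'
    obtain ⟨p, rfl⟩ := hcmem
    exact ⟨_, hjf p.1 p.2, fun a b => hcmin _ ⟨(a, b), rfl⟩⟩
  refine ⟨p₀ * p₀, mul_pos hp₀ hp₀, fun A hle hsum a b c d => ?_⟩
  have hA : ∀ a b, 0 ≤ A a b := fun a b => (h0 a b).trans (hle a b)
  have hi : p₀ ≤ (A ^ jf c a) c a := (hp₀le c a).trans (nonnegMat_pow_apply_mono h0 hle _ c a)
  have hj : p₀ ≤ (A ^ jf b d) b d := (hp₀le b d).trans (nonnegMat_pow_apply_mono h0 hle _ b d)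
  have hS0 : 0 ≤ neumannSum A a b := tsum_nonneg fun k => nonnegMat_pow_apply_nonneg hA k a b
  -- `(A^i)_{ca} (A^k)_{ab} (A^j)_{bd} ≤ (A^{k+(i+j)})_{cd}`
  have hterm : ∀ k, (A ^ jf c a) c a * (A ^ k) a b * (A ^ jf b d) b d ≤ (A ^ (k + (jf c a + jf b d))) c d := fun k => by
    have h1 := nonnegMat_mul_pow_apply_le_pow_add_apply hA (jf c a) k c a b
    have h2 := nonnegMat_mul_pow_apply_le_pow_add_apply hA (jf c a + k) (jf b d) c b d
    have h3 : 0 ≤ (A ^ jf b d) b d := nonnegMat_pow_apply_nonneg hA _ b d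
    calc (A ^ jf c a) c a * (A ^ k) a b * (A ^ jf b d) b d ≤ (A ^ (jf c a + k)) c b * (A ^ jf b d) b d :=
          mul_le_mul_of_nonneg_right h1 h3
      _ ≤ (A ^ (jf c a + k + jf b d)) c d := h2
      _ = (A ^ (k + (jf c a + jf b d))) c d := by rw [show jf c a + k + jf b d = k + (jf c a + jf b d) by omega]
  have hsum' : Summable fun k => (A ^ (k + (jf c a + jf b d))) c d := (summable_nat_add_iff _).2 (hsum c d)
  have hsum'' : Summable fun k => (A ^ jf c a) c a * (A ^ k) a b * (A ^ jf b d) b d :=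
    ((hsum a b).mul_left ((A ^ jf c a) c a)).mul_right ((A ^ jf b d) b d)
  calc p₀ * p₀ * neumannSum A a b ≤ (A ^ jf c a) c a * (A ^ jf b d) b d * neumannSum A a b := by
        have := mul_le_mul hi hj hp₀.le ((hp₀.le).trans hi)
        exact mul_le_mul_of_nonneg_right this hS0
    _ = ∑' k, (A ^ jf c a) c a * (A ^ k) a b * (A ^ jf b d) b d := by
        rw [mul_right_comm, neumannSum, ← tsum_mul_left, ← tsum_mul_right]
    _ ≤ ∑' k, (A ^ (k + (jf c a + jf b d))) c d := hsum''.tsum_le_tsum hterm hsum'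
    _ ≤ neumannSum A c d := tsum_shift_le (hsum c d) (fun k => nonnegMat_pow_apply_nonneg hA k c d) _

end Spread

/-! ### §C The setting: a monotone, convex, irreducible family with summable Neumann series and two-sided first-order bounds -/

section Family

/-- **The setting.** `y ↦ I(y)` on `[y₀, R)` (`y₀ < R`): entrywise non-negative, non-decreasing and convex; `I(y₀)` irreducible;
every entry series `Σ_k (I(y)^k)_{ab}` summable; and the Neumann sum obeys the two-sided first-order bounds
`c/(R − y) ≤ S(y)_{ab} ≤ C/(R − y)` (`0 < c`) for every entry. [cite: Seneta1973, Chapter 6 (R-theory: §6.1 Theorem 6.1, §6.2 Theorem 6.3); lane «pcv-sawmu» (the horizontal-bridge kernel of the honeycomb strip at its surface threshold)] -/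
structure NeumannFamily (I : ℝ → Matrix ι ι ℝ) (y₀ R c C : ℝ) : Prop where
  lt : y₀ < R
  pos : 0 < c
  nonneg : ∀ y ∈ Set.Ico y₀ R, ∀ a b, 0 ≤ I y a b
  mono : ∀ ⦃y y'⦄, y ∈ Set.Ico y₀ R → y' ∈ Set.Ico y₀ R → y ≤ y' → ∀ a b, I y a b ≤ I y' a b
  convex : ∀ a b, ConvexOn ℝ (Set.Ico y₀ R) fun y => I y a b
  irred : ∀ a b, ∃ j, 0 < (I y₀ ^ j) a b
  summable : ∀ y ∈ Set.Ico y₀ R, ∀ a b, Summable fun k => (I y ^ k) a b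
  lower : ∀ y ∈ Set.Ico y₀ R, ∀ a b, c / (R - y) ≤ neumannSum (I y) a b
  upper : ∀ y ∈ Set.Ico y₀ R, ∀ a b, neumannSum (I y) a b ≤ C / (R - y)

/-- `K (R − y) → 0` as `y ↑ R` (plumbing). [cite: Seneta1973, §6.2] -/
private theorem tendsto_const_mul_sub_nhdsLT (K R : ℝ) : Tendsto (fun y => K * (R - y)) (𝓝[<] R) (𝓝 0) := by
  have : Tendsto (fun y : ℝ => K * (R - y)) (𝓝 R) (𝓝 (K * (R - R))) :=
    (tendsto_const_nhds.sub tendsto_id).const_mul _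
  rw [sub_self, mul_zero] at this
  exact this.mono_left nhdsWithin_le_nhds

omit [Fintype ι] [DecidableEq ι] in
/-- Entrywise convergence of matrices (plumbing). [cite: Seneta1973, §6.2] -/
private theorem tendsto_matrix_iff {α : Type*} {l : Filter α} {f : α → Matrix ι ι ℝ} {M : Matrix ι ι ℝ} :
    Tendsto f l (𝓝 M) ↔ ∀ p q, Tendsto (fun x => f x p q) l (𝓝 (M p q)) :=
  (tendsto_pi_nhds (f := f) (g := M)).trans (forall_congr' fun _ => tendsto_pi_nhds)

/-- In a Hausdorff space a cluster value of a convergent function is its limit (plumbing). [cite: Seneta1973, §6.2] -/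
private theorem eq_of_mapClusterPt_of_tendsto' {α X : Type*} [TopologicalSpace X] [T2Space X] {l : Filter α} {u : α → X}
    {x y : X} (hx : MapClusterPt x l u) (hy : Tendsto u l (𝓝 y)) : x = y := by
  have h : ClusterPt x (𝓝 y) := ClusterPt.mono hx.clusterPt hy
  exact eq_of_nhds_neBot h.neBot

/-- A cluster value of a function with values eventually in a closed set lies in that set (plumbing). [cite: Seneta1973, §6.2] -/
private theorem mem_of_mapClusterPt_of_eventually {α X : Type*} [TopologicalSpace X] {l : Filter α} {u : α → X} {x : X}
    {s : Set X} (hs : IsClosed s) (hx : MapClusterPt x l u) (hu : ∀ᶠ a in l, u a ∈ s) : x ∈ s := by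
  have h : ClusterPt x (𝓟 s) := ClusterPt.mono hx.clusterPt (le_principal_iff.2 (mem_map.2 hu))
  rw [← hs.closure_eq]
  exact mem_closure_iff_clusterPt.2 h

/-- Pairing a cluster value with a limit (plumbing): if `x` is a cluster value of `u` along `l` and `v → y` along `l`, then
`(x, y)` is a cluster value of `(u, v)`. [cite: Seneta1973, §6.2] -/
private theorem mapClusterPt_prod_of_tendsto {α X Y : Type*} [TopologicalSpace X] [TopologicalSpace Y] {l : Filter α}
    {u : α → X} {v : α → Y} {x : X} {y : Y} (hx : MapClusterPt x l u) (hy : Tendsto v l (𝓝 y)) :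
    MapClusterPt (x, y) l fun a => (u a, v a) := by
  rw [mapClusterPt_iff_frequently]
  intro s hs
  obtain ⟨s₁, hs₁, s₂, hs₂, hsub⟩ := mem_nhds_prod_iff.1 hs
  have h1 : ∃ᶠ a in l, u a ∈ s₁ := (mapClusterPt_iff_frequently.1 hx) s₁ hs₁
  have h2 : ∀ᶠ a in l, v a ∈ s₂ := hy hs₂
  exact (h1.and_eventually h2).mono fun a ha => hsub (Set.mk_mem_prod ha.1 ha.2)

omit [Fintype ι] [DecidableEq ι] in
/-- The box `{M | c ≤ M_{pq} ≤ C}` is compact (plumbing). [cite: Seneta1973, §6.2] -/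
private theorem isCompact_matrix_box (c C : ℝ) : IsCompact {M : Matrix ι ι ℝ | ∀ p q, M p q ∈ Set.Icc c C} := by
  have hset : {M : Matrix ι ι ℝ | ∀ p q, M p q ∈ Set.Icc c C} =
      (Set.pi Set.univ fun _ : ι => Set.pi Set.univ fun _ : ι => Set.Icc c C : Set (ι → ι → ℝ)) := by
    ext M
    exact ⟨fun hM => Set.mem_univ_pi.2 fun p => Set.mem_univ_pi.2 fun q => hM p q,
      fun hM p q => Set.mem_univ_pi.1 (Set.mem_univ_pi.1 hM p) q⟩
  rw [hset]
  exact isCompact_univ_pi fun _ => isCompact_univ_pi fun _ => isCompact_Icc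

namespace NeumannFamily

variable {I : ℝ → Matrix ι ι ℝ} {y₀ R c C : ℝ} (hF : NeumannFamily I y₀ R c C)
include hF

/-- `y₀ ∈ [y₀, R)` (plumbing). [cite: Seneta1973, §6.1] -/
theorem y₀_mem : y₀ ∈ Set.Ico y₀ R := ⟨le_rfl, hF.lt⟩

/-- `S(y) ≥ 0` entrywise. [cite: Seneta1973, §6.1] -/
theorem neumannSum_nonneg {y : ℝ} (hy : y ∈ Set.Ico y₀ R) (a b : ι) : 0 ≤ neumannSum (I y) a b :=
  tsum_nonneg fun k => nonnegMat_pow_apply_nonneg (hF.nonneg y hy) k a b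

/-- `0 < C` (as soon as there is an index). [cite: Seneta1973, §6.1] -/
theorem pos_C [Nonempty ι] : 0 < C := by
  obtain ⟨a⟩ := ‹Nonempty ι›
  have h1 := (hF.lower y₀ hF.y₀_mem a a).trans (hF.upper y₀ hF.y₀_mem a a)
  have hR : 0 < R - y₀ := sub_pos.2 hF.lt
  have := (div_le_div_iff_of_pos_right hR).1 h1
  linarith [hF.pos]

/-- **The resolvent bound on increments.** For `y ≤ y'` in `[y₀, R)` and all `p, q`:
`I(y')_{pq} − I(y)_{pq} ≤ (C/c²) (R − y)`.  (From `S(y') ≥ S(y') (I(y') − I(y)) S(y) ≥ S(y')_{pp} (I(y') − I(y))_{pq} S(y)_{qq}`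
and the two-sided bounds.) [cite: Seneta1973, §6.1 (resolvent inequalities t^{(ν+k)} ≥ t^{(ν)} t^{(k)}); lane form] -/
theorem sub_le_mul_sub {y y' : ℝ} (hy : y ∈ Set.Ico y₀ R) (hy' : y' ∈ Set.Ico y₀ R) (hyy : y ≤ y') (p q : ι) :
    I y' p q - I y p q ≤ C / c ^ 2 * (R - y) := by
  have hS := hF.summable y hy
  have hS' := hF.summable y' hy'
  have hres := neumannSum_sub_neumannSum hS hS'
  -- entry (p,q) of the resolvent identity, bounded below by one term of the double sum
  have hE : ∀ a b, 0 ≤ (I y' - I y) a b := fun a b => by rw [Matrix.sub_apply]; linarith [hF.mono hy hy' hyy a b]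
  have hSn := hF.neumannSum_nonneg hy
  have hSn' := hF.neumannSum_nonneg hy'
  have h1 : neumannSum (I y') p p * (I y' - I y) p q * neumannSum (I y) q q
      ≤ (neumannSum (I y') * (I y' - I y) * neumannSum (I y)) p q := by
    rw [Matrix.mul_apply]
    refine le_trans ?_ (Finset.single_le_sum (f := fun r => (neumannSum (I y') * (I y' - I y)) p r * neumannSum (I y) r q)
      (fun r _ => mul_nonneg ?_ (hSn r q)) (Finset.mem_univ q))
    · refine mul_le_mul_of_nonneg_right ?_ (hSn q q)
      rw [Matrix.mul_apply]
      exact Finset.single_le_sum (f := fun r => neumannSum (I y') p r * (I y' - I y) r q)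
        (fun r _ => mul_nonneg (hSn' p r) (hE r q)) (Finset.mem_univ p)
    · rw [Matrix.mul_apply]; exact Finset.sum_nonneg fun r' _ => mul_nonneg (hSn' p r') (hE r' r)
  rw [← hres, Matrix.sub_apply] at h1
  have hRy : 0 < R - y := sub_pos.2 hy.2
  have hRy' : 0 < R - y' := sub_pos.2 hy'.2
  have hlo' : c / (R - y') ≤ neumannSum (I y') p p := hF.lower y' hy' p p
  have hlo : c / (R - y) ≤ neumannSum (I y) q q := hF.lower y hy q q
  have hup' : neumannSum (I y') p q ≤ C / (R - y') := hF.upper y' hy' p q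
  have hc := hF.pos
  -- (c/(R−y')) E (c/(R−y)) ≤ S' E S ≤ S'_{pq} − S_{pq} ≤ C/(R−y')
  have h2 : c / (R - y') * (I y' - I y) p q * (c / (R - y)) ≤ C / (R - y') := by
    calc c / (R - y') * (I y' - I y) p q * (c / (R - y))
        ≤ neumannSum (I y') p p * (I y' - I y) p q * neumannSum (I y) q q := by
          have hEpq := hE p q
          refine mul_le_mul (mul_le_mul_of_nonneg_right hlo' hEpq) hlo (by positivity) ?_
          exact mul_nonneg (hSn' p p) hEpq
      _ ≤ neumannSum (I y') p q - neumannSum (I y) p q := h1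
      _ ≤ C / (R - y') := by linarith [hSn p q]
  -- clear denominators
  have h2' : c / (R - y') * (I y' p q - I y p q) * (c / (R - y)) ≤ C / (R - y') := by
    simpa only [Matrix.sub_apply] using h2
  set E : ℝ := I y' p q - I y p q with hEdef
  have h3 : c * E * c ≤ C * (R - y) := by
    have e1 : c / (R - y') * E * (c / (R - y)) = (c * E * c / (R - y)) / (R - y') := by
      field_simp
    rw [e1, div_le_div_iff_of_pos_right hRy', div_le_iff₀ hRy] at h2'
    exact h2'
  have hc2 : 0 < c ^ 2 := by positivity
  rw [div_mul_eq_mul_div, le_div_iff₀ hc2]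
  nlinarith [h3]

/-- The increment constant `K = C/c²` is non-negative. [cite: Seneta1973, §6.1] -/
theorem K_nonneg [Nonempty ι] : 0 ≤ C / c ^ 2 := div_nonneg hF.pos_C.le (by positivity)

/-- Entries are bounded on `[y₀, R)`: `I(y)_{pq} ≤ I(y₀)_{pq} + (C/c²)(R − y₀)`. [cite: Seneta1973, §6.2 Theorem 6.3 (finiteness at the convergence parameter); lane form] -/
theorem apply_le_bound {y : ℝ} (hy : y ∈ Set.Ico y₀ R) (p q : ι) : I y p q ≤ I y₀ p q + C / c ^ 2 * (R - y₀) := by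
  have := hF.sub_le_mul_sub hF.y₀_mem hy hy.1 p q
  linarith

/-- `BddAbove` of the entry family over `[y₀, R)`. [cite: Seneta1973, §6.2] -/
theorem bddAbove_apply (p q : ι) : BddAbove (Set.range fun y : Set.Ico y₀ R => I y p q) :=
  ⟨I y₀ p q + C / c ^ 2 * (R - y₀), by rintro _ ⟨y, rfl⟩; exact hF.apply_le_bound y.2 p q⟩

/-- **The limit matrix** `I(R⁻)_{pq} = sup_{y < R} I(y)_{pq}`. [cite: Seneta1973, §6.2 (the matrix at the convergence parameter)] -/
def Ilim (_hF : NeumannFamily I y₀ R c C) : Matrix ι ι ℝ := fun p q => ⨆ y : Set.Ico y₀ R, I y p q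

/-- `I(y) ≤ I(R⁻)` entrywise. [cite: Seneta1973, §6.2 (monotone limits at the convergence parameter)] -/
theorem apply_le_Ilim {y : ℝ} (hy : y ∈ Set.Ico y₀ R) (p q : ι) : I y p q ≤ hF.Ilim p q :=
  le_ciSup (hF.bddAbove_apply p q) ⟨y, hy⟩

/-- `0 ≤ I(R⁻) − I(y) ≤ (C/c²)(R − y)`: the family is Lipschitz AT the endpoint. [cite: Seneta1973, §6.2; lane form (finite "mean renewal time")] -/
theorem Ilim_sub_le {y : ℝ} (hy : y ∈ Set.Ico y₀ R) (p q : ι) : hF.Ilim p q - I y p q ≤ C / c ^ 2 * (R - y) := by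
  have hne : Nonempty (Set.Ico y₀ R) := ⟨⟨y₀, hF.y₀_mem⟩⟩
  have h : hF.Ilim p q ≤ I y p q + C / c ^ 2 * (R - y) := by
    refine ciSup_le fun y' => ?_
    rcases le_total y (y' : ℝ) with hle | hle
    · have := hF.sub_le_mul_sub hy y'.2 hle p q
      linarith
    · have h1 := hF.mono y'.2 hy hle p q
      have h2 : 0 ≤ C / c ^ 2 * (R - y) := by
        have := hF.sub_le_mul_sub hy hy le_rfl p q
        simpa using this
      linarith
  linarith

/-- `0 ≤ I(R⁻) − I(y)` entrywise (plumbing). [cite: Seneta1973, §6.2] -/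
theorem Ilim_nonneg_sub {y : ℝ} (hy : y ∈ Set.Ico y₀ R) (p q : ι) : 0 ≤ hF.Ilim p q - I y p q :=
  sub_nonneg.2 (hF.apply_le_Ilim hy p q)

/-- `I(y₀) ≤ I(R⁻)`, so `I(R⁻) ≥ 0` and `I(R⁻)` is irreducible. [cite: Seneta1973, §1.1, §6.2] -/
theorem Ilim_nonneg (p q : ι) : 0 ≤ hF.Ilim p q :=
  (hF.nonneg y₀ hF.y₀_mem p q).trans (hF.apply_le_Ilim hF.y₀_mem p q)

/-- `I(R⁻)` is irreducible (it dominates `I(y₀)`). [cite: Seneta1973, §1.1 (irreducibility is monotone in the entries)] -/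
theorem Ilim_irred (p q : ι) : ∃ j, 0 < (hF.Ilim ^ j) p q := by
  obtain ⟨j, hj⟩ := hF.irred p q
  exact ⟨j, hj.trans_le (nonnegMat_pow_apply_mono (hF.nonneg y₀ hF.y₀_mem) (fun a b => hF.apply_le_Ilim hF.y₀_mem a b) j p q)⟩

/-- Eventually (as `y ↑ R`) `y ∈ [y₀, R)` (plumbing). [cite: Seneta1973, §6.2] -/
theorem eventually_mem : ∀ᶠ y in 𝓝[<] R, y ∈ Set.Ico y₀ R := Ico_mem_nhdsLT hF.lt

/-- `I(y) → I(R⁻)` entrywise as `y ↑ R`. [cite: Seneta1973, §6.2] -/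
theorem tendsto_apply_Ilim (p q : ι) : Tendsto (fun y => I y p q) (𝓝[<] R) (𝓝 (hF.Ilim p q)) := by
  have hlow : Tendsto (fun y => hF.Ilim p q - C / c ^ 2 * (R - y)) (𝓝[<] R) (𝓝 (hF.Ilim p q)) := by
    have := tendsto_const_nhds (x := hF.Ilim p q) (f := 𝓝[<] R) |>.sub (tendsto_const_mul_sub_nhdsLT (C / c ^ 2) R)
    rwa [sub_zero] at this
  refine tendsto_of_tendsto_of_tendsto_of_le_of_le' hlow tendsto_const_nhds
    (hF.eventually_mem.mono fun y hy => ?_) (hF.eventually_mem.mono fun y hy => hF.apply_le_Ilim hy p q)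
  linarith [hF.Ilim_sub_le hy p q]

/-- **The chord slopes to the endpoint** `D(y)_{pq} = (I(R⁻)_{pq} − I(y)_{pq})/(R − y)`. [cite: Seneta1973, §6.2; lane form] -/
def slope (_hF : NeumannFamily I y₀ R c C) (y : ℝ) : Matrix ι ι ℝ := fun p q => (_hF.Ilim p q - I y p q) / (R - y)

/-- The defining formula of the chord slope (plumbing). [cite: Seneta1973, §6.2] -/
theorem slope_apply (y : ℝ) (p q : ι) : hF.slope y p q = (hF.Ilim p q - I y p q) / (R - y) := rfl

/-- `0 ≤ D(y)` (plumbing). [cite: Seneta1973, §6.2] -/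
theorem slope_nonneg {y : ℝ} (hy : y ∈ Set.Ico y₀ R) (p q : ι) : 0 ≤ hF.slope y p q :=
  div_nonneg (hF.Ilim_nonneg_sub hy p q) (sub_pos.2 hy.2).le

/-- `D(y) ≤ C/c²` (the endpoint Lipschitz bound). [cite: Seneta1973, §6.2; lane form] -/
theorem slope_le {y : ℝ} (hy : y ∈ Set.Ico y₀ R) (p q : ι) : hF.slope y p q ≤ C / c ^ 2 :=
  (div_le_iff₀ (sub_pos.2 hy.2)).2 (hF.Ilim_sub_le hy p q)

/-- The finite secant inequality of a convex entry: for `y₁ < y₂ < z` in `[y₀, R)`,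
`(I(z) − I(y₁))/(z − y₁) ≤ (I(z) − I(y₂))/(z − y₂)`. [cite: Seneta1973, §6.2; convexity of power series with non-negative coefficients] -/
theorem secant_le {y₁ y₂ z : ℝ} (hy₁ : y₁ ∈ Set.Ico y₀ R) (hz : z ∈ Set.Ico y₀ R) (h12 : y₁ < y₂) (h2z : y₂ < z)
    (p q : ι) : (I z p q - I y₁ p q) / (z - y₁) ≤ (I z p q - I y₂ p q) / (z - y₂) :=
  (hF.convex p q).secant_mono_aux3 hy₁ hz h12 h2z

/-- **Monotonicity of the chord slopes to the endpoint**: `y₁ ≤ y₂` ⇒ `D(y₁) ≤ D(y₂)` entrywise (let `z ↑ R` in `secant_le`).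
[cite: Seneta1973, §6.2; lane form] -/
theorem slope_mono {y₁ y₂ : ℝ} (hy₁ : y₁ ∈ Set.Ico y₀ R) (hy₂ : y₂ ∈ Set.Ico y₀ R) (h12 : y₁ ≤ y₂) (p q : ι) :
    hF.slope y₁ p q ≤ hF.slope y₂ p q := by
  rcases eq_or_lt_of_le h12 with rfl | h12
  · exact le_rfl
  -- both sides are limits of the finite secants as `z ↑ R`
  have hlim : ∀ {y : ℝ}, y ∈ Set.Ico y₀ R →
      Tendsto (fun z => (I z p q - I y p q) / (z - y)) (𝓝[<] R) (𝓝 (hF.slope y p q)) := by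
    intro y hy
    rw [slope_apply]
    refine ((hF.tendsto_apply_Ilim p q).sub tendsto_const_nhds).div ?_ (sub_pos.2 hy.2).ne'
    exact (tendsto_id.mono_left nhdsWithin_le_nhds).sub tendsto_const_nhds
  have hev : ∀ᶠ z in 𝓝[<] R, (I z p q - I y₁ p q) / (z - y₁) ≤ (I z p q - I y₂ p q) / (z - y₂) := by
    have h2 : ∀ᶠ z in 𝓝[<] R, z ∈ Set.Ioo y₂ R := Ioo_mem_nhdsLT hy₂.2
    filter_upwards [h2] with z hz
    exact hF.secant_le hy₁ ⟨hy₂.1.trans hz.1.le, hz.2⟩ h12 hz.1 p q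
  exact le_of_tendsto_of_tendsto (hlim hy₁) (hlim hy₂) hev

/-- `BddAbove` of the slopes along `[y₀, R)`. [cite: Seneta1973, §6.2] -/
theorem bddAbove_slope (p q : ι) : BddAbove (Set.range fun y : Set.Ico y₀ R => hF.slope y p q) :=
  ⟨C / c ^ 2, by rintro _ ⟨y, rfl⟩; exact hF.slope_le y.2 p q⟩

/-- **The left derivative at the endpoint** `J_{pq} = sup_{y<R} D(y)_{pq} = lim_{y↑R} (I(R⁻) − I(y))/(R − y)` (finite!).
[cite: Seneta1973, §6.2; lane form (the "finite mean" of the renewal structure comes for free from the lower first-order bound)] -/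
def J (_hF : NeumannFamily I y₀ R c C) : Matrix ι ι ℝ := fun p q => ⨆ y : Set.Ico y₀ R, _hF.slope y p q

/-- `D(y) ≤ J` (plumbing). [cite: Seneta1973, §6.2] -/
theorem slope_le_J {y : ℝ} (hy : y ∈ Set.Ico y₀ R) (p q : ι) : hF.slope y p q ≤ hF.J p q :=
  le_ciSup (hF.bddAbove_slope p q) ⟨y, hy⟩

/-- `J ≤ C/c²`. [cite: Seneta1973, §6.2; lane form] -/
theorem J_le (p q : ι) : hF.J p q ≤ C / c ^ 2 :=
  have : Nonempty (Set.Ico y₀ R) := ⟨⟨y₀, hF.y₀_mem⟩⟩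
  ciSup_le fun y => hF.slope_le y.2 p q

/-- `0 ≤ J`. [cite: Seneta1973, §6.2] -/
theorem J_nonneg (p q : ι) : 0 ≤ hF.J p q := (hF.slope_nonneg hF.y₀_mem p q).trans (hF.slope_le_J hF.y₀_mem p q)

/-- `D(y) → J` entrywise as `y ↑ R` (monotone and bounded). [cite: Seneta1973, §6.2] -/
theorem tendsto_slope_J (p q : ι) : Tendsto (fun y => hF.slope y p q) (𝓝[<] R) (𝓝 (hF.J p q)) := by
  have : Nonempty (Set.Ico y₀ R) := ⟨⟨y₀, hF.y₀_mem⟩⟩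
  rw [tendsto_order]
  refine ⟨fun t ht => ?_, fun t ht => hF.eventually_mem.mono fun y hy => (hF.slope_le_J hy p q).trans_lt ht⟩
  -- pick `y₁` with `D(y₁) > t`; then for `y ∈ [y₁, R)` monotonicity gives `D(y) > t`
  obtain ⟨⟨y₁, hy₁⟩, h1⟩ : ∃ y : Set.Ico y₀ R, t < hF.slope y p q := exists_lt_of_lt_ciSup ht
  have h2 : ∀ᶠ y in 𝓝[<] R, y ∈ Set.Ico y₁ R := Ico_mem_nhdsLT hy₁.2
  filter_upwards [h2] with y hy
  exact h1.trans_le (hF.slope_mono hy₁ ⟨hy₁.1.trans hy.1, hy.2⟩ hy.1 p q)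

/-! ### §D The rescaled Neumann sums `Q(y) = (R − y) S(y)` and their cluster values -/

/-- `Q(y) = (R − y) · S(y)`. [cite: Seneta1973, §6.2; lane form] -/
def Q (_hF : NeumannFamily I y₀ R c C) (y : ℝ) : Matrix ι ι ℝ := (R - y) • neumannSum (I y)

/-- The defining formula of `Q` entrywise (plumbing). [cite: Seneta1973, §6.2] -/
theorem Q_apply (y : ℝ) (p q : ι) : hF.Q y p q = (R - y) * neumannSum (I y) p q := by
  simp [Q, Matrix.smul_apply]

/-- `c ≤ Q(y)_{pq} ≤ C` on `[y₀, R)`. [cite: Seneta1973, §6.2; lane form] -/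
theorem Q_apply_mem {y : ℝ} (hy : y ∈ Set.Ico y₀ R) (p q : ι) : hF.Q y p q ∈ Set.Icc c C := by
  have hRy : 0 < R - y := sub_pos.2 hy.2
  rw [Q_apply]
  constructor
  · have := hF.lower y hy p q
    rw [div_le_iff₀ hRy] at this
    linarith
  · have := hF.upper y hy p q
    rw [le_div_iff₀ hRy] at this
    linarith

/-- `Q(y) (1 − I(y)) = (R − y) · 1`. [cite: Seneta1973, §6.1] -/
theorem Q_mul_one_sub {y : ℝ} (hy : y ∈ Set.Ico y₀ R) : hF.Q y * (1 - I y) = (R - y) • (1 : Matrix ι ι ℝ) := by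
  rw [Q, smul_mul_assoc, neumannSum_mul_one_sub (hF.summable y hy)]

/-- `(1 − I(y)) Q(y) = (R − y) · 1`. [cite: Seneta1973, §6.1] -/
theorem one_sub_mul_Q {y : ℝ} (hy : y ∈ Set.Ico y₀ R) : (1 - I y) * hF.Q y = (R - y) • (1 : Matrix ι ι ℝ) := by
  rw [Q, mul_smul_comm, one_sub_mul_neumannSum (hF.summable y hy)]

/-- `I(R⁻) − I(y) = (R − y) · D(y)` on `[y₀, R)`. [cite: Seneta1973, §6.2] -/
theorem Ilim_sub_eq_smul_slope {y : ℝ} (hy : y ∈ Set.Ico y₀ R) : hF.Ilim - I y = (R - y) • hF.slope y := by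
  ext p q
  have hRy : (R - y) ≠ 0 := (sub_pos.2 hy.2).ne'
  simp only [Matrix.sub_apply, Matrix.smul_apply, slope_apply, smul_eq_mul]
  field_simp

/-- `Q(y) (1 − I(R⁻)) → 0` as `y ↑ R`. [cite: Seneta1973, §6.2; lane form] -/
theorem tendsto_Q_mul_one_sub_Ilim : Tendsto (fun y => hF.Q y * (1 - hF.Ilim)) (𝓝[<] R) (𝓝 0) := by
  -- `Q (1 − Ilim) = (R − y)·1 − (R − y) · Q D`
  have heq : ∀ᶠ y in 𝓝[<] R, hF.Q y * (1 - hF.Ilim) = (R - y) • (1 : Matrix ι ι ℝ) - (R - y) • (hF.Q y * hF.slope y) :=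
    hF.eventually_mem.mono fun y hy => by
      have h1 : (1 : Matrix ι ι ℝ) - hF.Ilim = (1 - I y) - (hF.Ilim - I y) := by abel
      rw [h1, Matrix.mul_sub, hF.Q_mul_one_sub hy, hF.Ilim_sub_eq_smul_slope hy, mul_smul_comm]
  refine Tendsto.congr' (heq.mono fun y hy => hy.symm) ?_
  rw [show (0 : Matrix ι ι ℝ) = (0 : ℝ) • (1 : Matrix ι ι ℝ) - 0 by simp]
  refine Tendsto.sub ?_ ?_
  · exact ((tendsto_const_mul_sub_nhdsLT 1 R).congr fun y => by ring).smul tendsto_const_nhds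
  · -- `(R − y) • (Q D)` → 0: entries of `Q D` are bounded by `|ι| · C · (C/c²)`
    rw [tendsto_matrix_iff]
    intro p q
    simp only [Matrix.smul_apply, smul_eq_mul, Matrix.zero_apply]
    have hbd : ∀ᶠ y in 𝓝[<] R, |(hF.Q y * hF.slope y) p q| ≤ Fintype.card ι * (C * (C / c ^ 2)) :=
      hF.eventually_mem.mono fun y hy => by
        rw [Matrix.mul_apply, abs_of_nonneg (Finset.sum_nonneg fun r _ =>
          mul_nonneg ((hF.pos.le.trans (hF.Q_apply_mem hy p r).1)) (hF.slope_nonneg hy r q))]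
        calc ∑ r, hF.Q y p r * hF.slope y r q ≤ ∑ _r : ι, C * (C / c ^ 2) :=
              Finset.sum_le_sum fun r _ => mul_le_mul (hF.Q_apply_mem hy p r).2 (hF.slope_le hy r q)
                (hF.slope_nonneg hy r q) ((hF.pos.le.trans (hF.Q_apply_mem hy p r).1).trans (hF.Q_apply_mem hy p r).2)
          _ = Fintype.card ι * (C * (C / c ^ 2)) := by simp [Finset.sum_const, Finset.card_univ]
    have hK0 : 0 ≤ Fintype.card ι * (C * (C / c ^ 2)) := by
      have : 0 ≤ C := by
        obtain ⟨y, hy⟩ : ∃ y, y ∈ Set.Ico y₀ R := ⟨y₀, hF.y₀_mem⟩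
        exact (hF.pos.le.trans (hF.Q_apply_mem hy p p).1).trans (hF.Q_apply_mem hy p p).2
      have hc2 : 0 ≤ C / c ^ 2 := div_nonneg this (by positivity)
      positivity
    have hup : Tendsto (fun y => (Fintype.card ι * (C * (C / c ^ 2))) * (R - y)) (𝓝[<] R) (𝓝 0) :=
      tendsto_const_mul_sub_nhdsLT _ R
    refine tendsto_of_tendsto_of_tendsto_of_le_of_le' tendsto_const_nhds hup ?_ ?_
    · filter_upwards [hF.eventually_mem] with y hy
      refine mul_nonneg (sub_pos.2 hy.2).le ?_
      rw [Matrix.mul_apply]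
      exact Finset.sum_nonneg fun r _ => mul_nonneg ((hF.pos.le.trans (hF.Q_apply_mem hy p r).1)) (hF.slope_nonneg hy r q)
    · filter_upwards [hF.eventually_mem, hbd] with y hy hb
      rw [mul_comm]
      have hRy : 0 ≤ R - y := (sub_pos.2 hy.2).le
      calc (hF.Q y * hF.slope y) p q * (R - y) ≤ |(hF.Q y * hF.slope y) p q| * (R - y) :=
            mul_le_mul_of_nonneg_right (le_abs_self _) hRy
        _ ≤ Fintype.card ι * (C * (C / c ^ 2)) * (R - y) := mul_le_mul_of_nonneg_right hb hRy

/-- The relation `(Q(y) D(y)) u = u` for a fixed vector `u` of `I(R⁻)` (`y ∈ [y₀, R)`).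
[cite: Seneta1973, §6.2; lane form (normalisation of the residue)] -/
theorem Q_mul_slope_mulVec {u : ι → ℝ} (hu : hF.Ilim *ᵥ u = u) {y : ℝ} (hy : y ∈ Set.Ico y₀ R) :
    (hF.Q y * hF.slope y) *ᵥ u = u := by
  have hRy : (R - y) ≠ 0 := (sub_pos.2 hy.2).ne'
  -- `(1 − I y) u = (Ilim − I y) u = (R − y) • (D u)`
  have h1 : (1 - I y) *ᵥ u = (R - y) • (hF.slope y *ᵥ u) := by
    have : (1 : Matrix ι ι ℝ) - I y = (1 - hF.Ilim) + (hF.Ilim - I y) := by abel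
    rw [this, Matrix.add_mulVec, Matrix.sub_mulVec, Matrix.one_mulVec, hu, sub_self, zero_add,
      hF.Ilim_sub_eq_smul_slope hy, Matrix.smul_mulVec]
  have h2 : (hF.Q y * (1 - I y)) *ᵥ u = (R - y) • u := by
    rw [hF.Q_mul_one_sub hy, Matrix.smul_mulVec, Matrix.one_mulVec]
  rw [← Matrix.mulVec_mulVec, h1, Matrix.mulVec_smul] at h2
  rw [← Matrix.mulVec_mulVec]
  exact smul_right_injective _ hRy h2

/-- Entries of `D(y) Q(y)` and `Q(y) D(y)` are bounded by `|ι| · C · (C/c²)` on `[y₀, R)` (plumbing). [cite: Seneta1973, §6.2] -/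
theorem abs_slope_mul_Q_le {y : ℝ} (hy : y ∈ Set.Ico y₀ R) (p q : ι) :
    |(hF.slope y * hF.Q y) p q| ≤ Fintype.card ι * (C / c ^ 2 * C) := by
  rw [Matrix.mul_apply, abs_of_nonneg (Finset.sum_nonneg fun r _ =>
    mul_nonneg (hF.slope_nonneg hy p r) (hF.pos.le.trans (hF.Q_apply_mem hy r q).1))]
  calc ∑ r, hF.slope y p r * hF.Q y r q ≤ ∑ _r : ι, C / c ^ 2 * C :=
        Finset.sum_le_sum fun r _ => mul_le_mul (hF.slope_le hy p r) (hF.Q_apply_mem hy r q).2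
          (hF.pos.le.trans (hF.Q_apply_mem hy r q).1) ((hF.slope_nonneg hy p r).trans (hF.slope_le hy p r))
    _ = Fintype.card ι * (C / c ^ 2 * C) := by simp [Finset.sum_const, Finset.card_univ]

/-- `(1 − I(R⁻)) Q(y) → 0` as `y ↑ R`. [cite: Seneta1973, §6.2; lane form] -/
theorem tendsto_one_sub_Ilim_mul_Q : Tendsto (fun y => (1 - hF.Ilim) * hF.Q y) (𝓝[<] R) (𝓝 0) := by
  have heq : ∀ᶠ y in 𝓝[<] R, (1 - hF.Ilim) * hF.Q y = (R - y) • (1 : Matrix ι ι ℝ) - (R - y) • (hF.slope y * hF.Q y) :=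
    hF.eventually_mem.mono fun y hy => by
      have h1 : (1 : Matrix ι ι ℝ) - hF.Ilim = (1 - I y) - (hF.Ilim - I y) := by abel
      rw [h1, Matrix.sub_mul, hF.one_sub_mul_Q hy, hF.Ilim_sub_eq_smul_slope hy, smul_mul_assoc]
  refine Tendsto.congr' (heq.mono fun y hy => hy.symm) ?_
  rw [show (0 : Matrix ι ι ℝ) = (0 : ℝ) • (1 : Matrix ι ι ℝ) - 0 by simp]
  refine Tendsto.sub ?_ ?_
  · exact ((tendsto_const_mul_sub_nhdsLT 1 R).congr fun y => by ring).smul tendsto_const_nhds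
  · rw [tendsto_matrix_iff]
    intro p q
    simp only [Matrix.smul_apply, smul_eq_mul, Matrix.zero_apply]
    have hup : Tendsto (fun y => (Fintype.card ι * (C / c ^ 2 * C)) * (R - y)) (𝓝[<] R) (𝓝 0) :=
      tendsto_const_mul_sub_nhdsLT _ R
    refine tendsto_of_tendsto_of_tendsto_of_le_of_le' tendsto_const_nhds hup ?_ ?_
    · filter_upwards [hF.eventually_mem] with y hy
      refine mul_nonneg (sub_pos.2 hy.2).le ?_
      rw [Matrix.mul_apply]
      exact Finset.sum_nonneg fun r _ => mul_nonneg (hF.slope_nonneg hy p r) (hF.pos.le.trans (hF.Q_apply_mem hy r q).1)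
    · filter_upwards [hF.eventually_mem] with y hy
      rw [mul_comm]
      have hRy : 0 ≤ R - y := (sub_pos.2 hy.2).le
      calc (hF.slope y * hF.Q y) p q * (R - y) ≤ |(hF.slope y * hF.Q y) p q| * (R - y) :=
            mul_le_mul_of_nonneg_right (le_abs_self _) hRy
        _ ≤ Fintype.card ι * (C / c ^ 2 * C) * (R - y) := mul_le_mul_of_nonneg_right (hF.abs_slope_mul_Q_le hy p q) hRy

/-! ### §E Cluster values of `Q` as `y ↑ R` -/

section Cluster

variable {P : Matrix ι ι ℝ} (hP : MapClusterPt P (𝓝[<] R) hF.Q)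
include hP

/-- A cluster value has entries in `[c, C]`. [cite: Seneta1973, §6.2; lane form] -/
theorem cluster_apply_mem (p q : ι) : P p q ∈ Set.Icc c C := by
  have h := (hP.tendsto_comp (f := fun M : Matrix ι ι ℝ => M p q)
    (((continuous_apply q).comp (continuous_apply p)).tendsto P))
  exact mem_of_mapClusterPt_of_eventually isClosed_Icc h (hF.eventually_mem.mono fun y hy => hF.Q_apply_mem hy p q)

/-- A cluster value satisfies `P (1 − I(R⁻)) = 0`. [cite: Seneta1973, §6.2; lane form] -/
theorem cluster_mul_one_sub_Ilim : P * (1 - hF.Ilim) = 0 := by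
  have hcont : Continuous fun M : Matrix ι ι ℝ => M * (1 - hF.Ilim) := continuous_id.matrix_mul continuous_const
  have h := hP.tendsto_comp (hcont.tendsto P)
  exact eq_of_mapClusterPt_of_tendsto' h hF.tendsto_Q_mul_one_sub_Ilim

/-- A cluster value satisfies `(1 − I(R⁻)) P = 0`. [cite: Seneta1973, §6.2; lane form] -/
theorem one_sub_Ilim_mul_cluster : (1 - hF.Ilim) * P = 0 := by
  have hcont : Continuous fun M : Matrix ι ι ℝ => (1 - hF.Ilim) * M := continuous_const.matrix_mul continuous_id
  have h := hP.tendsto_comp (hcont.tendsto P)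
  exact eq_of_mapClusterPt_of_tendsto' h hF.tendsto_one_sub_Ilim_mul_Q

/-- Columns of a cluster value are fixed vectors of `I(R⁻)`; rows are fixed row vectors. [cite: Seneta1973, §6.2] -/
theorem Ilim_mulVec_cluster_col (b : ι) : hF.Ilim *ᵥ (fun a => P a b) = fun a => P a b := by
  have h := hF.one_sub_Ilim_mul_cluster hP
  rw [Matrix.sub_mul, Matrix.one_mul, sub_eq_zero] at h
  funext a
  have := congr_fun (congr_fun h a) b
  rw [Matrix.mul_apply] at this
  simp only [Matrix.mulVec, dotProduct]
  exact this.symm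

/-- Rows of a cluster value are fixed row vectors of `I(R⁻)`. [cite: Seneta1973, §6.2] -/
theorem cluster_row_vecMul_Ilim (a : ι) : (fun b => P a b) ᵥ* hF.Ilim = fun b => P a b := by
  have h := hF.cluster_mul_one_sub_Ilim hP
  rw [Matrix.mul_sub, Matrix.mul_one, sub_eq_zero] at h
  funext b
  have := congr_fun (congr_fun h a) b
  rw [Matrix.mul_apply] at this
  simp only [Matrix.vecMul, dotProduct]
  exact this.symm

/-- The normalisation `(P J) u = u` of a cluster value, for a fixed vector `u` of `I(R⁻)`. [cite: Seneta1973, §6.2; lane form] -/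
theorem cluster_mul_J_mulVec {u : ι → ℝ} (hu : hF.Ilim *ᵥ u = u) : (P * hF.J) *ᵥ u = u := by
  -- `(Q(y), D(y))` clusters at `(P, J)`; `(M, N) ↦ (M N) u` is continuous; the values are eventually the constant `u`
  have hJ : Tendsto hF.slope (𝓝[<] R) (𝓝 hF.J) := tendsto_matrix_iff.2 fun p q => hF.tendsto_slope_J p q
  have hpair := mapClusterPt_prod_of_tendsto hP hJ
  have hcont : Continuous fun MN : Matrix ι ι ℝ × Matrix ι ι ℝ => (MN.1 * MN.2) *ᵥ u :=
    (continuous_fst.matrix_mul continuous_snd).matrix_mulVec continuous_const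
  have h := hpair.tendsto_comp (hcont.tendsto (P, hF.J))
  have hconst : Tendsto ((fun MN : Matrix ι ι ℝ × Matrix ι ι ℝ => (MN.1 * MN.2) *ᵥ u) ∘ fun y => (hF.Q y, hF.slope y))
      (𝓝[<] R) (𝓝 u) :=
    tendsto_const_nhds.congr' (hF.eventually_mem.mono fun y hy => (hF.Q_mul_slope_mulVec hu hy).symm)
  exact eq_of_mapClusterPt_of_tendsto' h hconst

/-- **Structure of the cluster values.** Given positive fixed vectors `u` (right) and `ℓ` (left) of `I(R⁻)`, every cluster value
of `Q` is the rank-one matrix `u ℓᵀ/(ℓ · J u)` — in particular it is unique. [cite: Seneta1973, §6.2 and §1.4; lane form (no spectral theory)] -/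
theorem cluster_eq [Nonempty ι] {u ℓ : ι → ℝ} (hu0 : ∀ a, 0 < u a) (hu : hF.Ilim *ᵥ u = u) (hℓ0 : ∀ b, 0 < ℓ b)
    (hℓ : ℓ ᵥ* hF.Ilim = ℓ) :
    ℓ ⬝ᵥ (hF.J *ᵥ u) ≠ 0 ∧ P = (1 / (ℓ ⬝ᵥ (hF.J *ᵥ u))) • Matrix.vecMulVec u ℓ := by
  classical
  have hIn := hF.Ilim_nonneg
  have hIi := hF.Ilim_irred
  -- columns and rows are multiples of `u` and `ℓ`
  have hcol : ∀ b, ∃ t : ℝ, (fun a => P a b) = t • u := fun b =>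
    exists_eq_smul_of_mulVec_eq hIn hIi hu0 hu (hF.Ilim_mulVec_cluster_col hP b)
  have hrow : ∀ a, ∃ t : ℝ, (fun b => P a b) = t • ℓ := fun a =>
    exists_eq_smul_of_vecMul_eq hIn hIi hℓ0 hℓ (hF.cluster_row_vecMul_Ilim hP a)
  choose t ht using hcol
  choose r hr using hrow
  obtain ⟨a₀⟩ := ‹Nonempty ι›
  set κ : ℝ := r a₀ / u a₀ with hκ
  have hPab : ∀ a b, P a b = κ * (u a * ℓ b) := by
    intro a b
    have h1 : P a b = t b * u a := by simpa using congr_fun (ht b) a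
    have h2 : P a₀ b = t b * u a₀ := by simpa using congr_fun (ht b) a₀
    have h3 : P a₀ b = r a₀ * ℓ b := by simpa using congr_fun (hr a₀) b
    have h4 : t b = r a₀ * ℓ b / u a₀ := by
      rw [eq_div_iff (hu0 a₀).ne']; linarith
    rw [h1, h4, hκ]; ring
  -- normalisation at the row `a₀`
  have hnorm := congr_fun (hF.cluster_mul_J_mulVec hP hu) a₀
  rw [← Matrix.mulVec_mulVec] at hnorm
  change ∑ b, P a₀ b * (hF.J *ᵥ u) b = u a₀ at hnorm
  set X : ℝ := ℓ ⬝ᵥ (hF.J *ᵥ u) with hX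
  have hsum : κ * u a₀ * X = u a₀ := by
    calc κ * u a₀ * X = ∑ b, P a₀ b * (hF.J *ᵥ u) b := by
          rw [hX, dotProduct, Finset.mul_sum]
          refine Finset.sum_congr rfl fun b _ => ?_
          rw [hPab a₀ b]; ring
      _ = u a₀ := hnorm
  have hκJ : κ * X = 1 := by
    have hu := hu0 a₀
    have h' : (κ * X) * u a₀ = 1 * u a₀ := by
      rw [one_mul]
      calc (κ * X) * u a₀ = κ * u a₀ * X := by ring
        _ = u a₀ := hsum
    exact mul_right_cancel₀ hu.ne' h'
  have hne : X ≠ 0 := fun h => by rw [h, mul_zero] at hκJ; exact zero_ne_one hκJ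
  have hκ' : κ = 1 / X := by rw [eq_div_iff hne]; exact hκJ
  refine ⟨hne, ?_⟩
  ext a b
  rw [Matrix.smul_apply, Matrix.vecMulVec_apply, smul_eq_mul, hPab a b, hκ']

end Cluster

/-! ### §F The residue theorem -/

/-- ★★★ **THE RESIDUE THEOREM (no Perron–Frobenius).** In the setting `NeumannFamily I y₀ R c C` there are positive vectors
`u` (with `I(R⁻) u = u`) and `ℓ` (with `ℓ I(R⁻) = ℓ`), `ℓ · J u > 0` for the endpoint derivative `J`, and
`(R − y) · Σ_k I(y)^k ⟶ u ℓᵀ / (ℓ · J u)` as `y ↑ R` — a rank-one residue with all entries positive.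
[cite: Seneta1973, Chapter 6 (§6.1 Theorem 6.1, §6.2 Theorem 6.3) and §1.4; Feller1971, XIV §1 (renewal equation); lane «pcv-sawmu» — the residue of the strip's horizontal-bridge kernel; the proof by compactness and uniqueness of cluster values is the lane's] -/
theorem exists_tendsto_Q [Nonempty ι] :
    ∃ u ℓ : ι → ℝ, (∀ a, 0 < u a) ∧ (∀ b, 0 < ℓ b) ∧ hF.Ilim *ᵥ u = u ∧ ℓ ᵥ* hF.Ilim = ℓ ∧
      0 < ℓ ⬝ᵥ (hF.J *ᵥ u) ∧
      Tendsto hF.Q (𝓝[<] R) (𝓝 ((1 / (ℓ ⬝ᵥ (hF.J *ᵥ u))) • Matrix.vecMulVec u ℓ)) := by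
  classical
  have hK := isCompact_matrix_box (ι := ι) c C
  have hmem : ∀ᶠ y in 𝓝[<] R, hF.Q y ∈ {M : Matrix ι ι ℝ | ∀ p q, M p q ∈ Set.Icc c C} :=
    hF.eventually_mem.mono fun y hy p q => hF.Q_apply_mem hy p q
  -- one cluster value `P₀`
  obtain ⟨P₀, -, hP₀⟩ := hK.exists_mapClusterPt (f := 𝓝[<] R) (u := hF.Q) (le_principal_iff.2 (mem_map.2 hmem))
  obtain ⟨a₀⟩ := ‹Nonempty ι›
  set u : ι → ℝ := fun a => P₀ a a₀ with hudef
  set ℓ : ι → ℝ := fun b => P₀ a₀ b with hℓdef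
  have hu0 : ∀ a, 0 < u a := fun a => hF.pos.trans_le (hF.cluster_apply_mem hP₀ a a₀).1
  have hℓ0 : ∀ b, 0 < ℓ b := fun b => hF.pos.trans_le (hF.cluster_apply_mem hP₀ a₀ b).1
  have hu : hF.Ilim *ᵥ u = u := hF.Ilim_mulVec_cluster_col hP₀ a₀
  have hℓ : ℓ ᵥ* hF.Ilim = ℓ := hF.cluster_row_vecMul_Ilim hP₀ a₀
  obtain ⟨hne, hP₀eq⟩ := hF.cluster_eq hP₀ hu0 hu hℓ0 hℓ
  -- positivity of `ℓ · J u` from the positivity of `P₀`'s entries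
  have hpos : 0 < ℓ ⬝ᵥ (hF.J *ᵥ u) := by
    have h1 : c ≤ P₀ a₀ a₀ := (hF.cluster_apply_mem hP₀ a₀ a₀).1
    rw [hP₀eq, Matrix.smul_apply, Matrix.vecMulVec_apply, smul_eq_mul] at h1
    have h2 : 0 < 1 / (ℓ ⬝ᵥ (hF.J *ᵥ u)) * (u a₀ * ℓ a₀) := hF.pos.trans_le h1
    have h3 : 0 < u a₀ * ℓ a₀ := mul_pos (hu0 a₀) (hℓ0 a₀)
    have h4 : 0 < 1 / (ℓ ⬝ᵥ (hF.J *ᵥ u)) := by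
      by_contra hle
      rw [not_lt] at hle
      nlinarith [h3]
    exact one_div_pos.1 h4
  refine ⟨u, ℓ, hu0, hℓ0, hu, hℓ, hpos, ?_⟩
  exact hK.tendsto_nhds_of_unique_mapClusterPt hmem fun P _ hP => (hF.cluster_eq hP hu0 hu hℓ0 hℓ).2

/-- ★★★ Entrywise form: `(R − y) · (Σ_k I(y)^k)_{pq} → u_p ℓ_q/(ℓ · J u)`, a positive limit, for every `p, q`.
[cite: Seneta1973, Chapter 6; Feller1971, XIV §1; lane «pcv-sawmu»] -/
theorem exists_tendsto_mul_neumannSum_apply [Nonempty ι] :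
    ∃ u ℓ : ι → ℝ, (∀ a, 0 < u a) ∧ (∀ b, 0 < ℓ b) ∧ hF.Ilim *ᵥ u = u ∧ ℓ ᵥ* hF.Ilim = ℓ ∧
      0 < ℓ ⬝ᵥ (hF.J *ᵥ u) ∧ ∀ p q,
      Tendsto (fun y => (R - y) * neumannSum (I y) p q) (𝓝[<] R) (𝓝 (u p * ℓ q / (ℓ ⬝ᵥ (hF.J *ᵥ u)))) := by
  obtain ⟨u, ℓ, hu0, hℓ0, hu, hℓ, hpos, hT⟩ := hF.exists_tendsto_Q
  refine ⟨u, ℓ, hu0, hℓ0, hu, hℓ, hpos, fun p q => ?_⟩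
  have h := (tendsto_matrix_iff.1 hT) p q
  simp only [Q_apply, Matrix.smul_apply, Matrix.vecMulVec_apply, smul_eq_mul] at h
  convert h using 2
  ring


end NeumannFamily


end Family

end Literature.Analysis.Matrix
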